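import Summits.Langlands.Langlands.Theses.EvenIcosahedralCMCorner
import Literature.Algebra.Homology.InflationRestrictionHigher
import Literature.Algebra.Homology.GroupCohomologyRestrictionCorestriction
import Literature.Algebra.Homology.GroupCohomologyFiniteGroupVanishing
import Literature.NumberTheory.GaloisRepresentations.SerreProp16PGL2Cor
import HarnessLib

/-!
# `EvenIcosahedralCMCorner.DefectZeroA5` (stmt-Langlands-14080) — proved

[proof of `Summit.Langlands.Langlands.Theses.EvenIcosahedralCMCorner.DefectZeroA5`
(route `EvenIcosahedralCMCorner`, support item, rank 9)]

**Statement.**  For every field `k` of characteristic `3` and every irreducible `3`-dimensional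
`k`-representation `V` of `A₅`: `H¹(A₅, V) = H²(A₅, V) = 0` (`Subsingleton` of `groupCohomology.Hⁱ`).

**Proof (block theory bypassed — a Klein-four eigenline dichotomy).**  Let
`A = (0 1)(2 3)`, `B = (0 2)(1 3)`, `C = (0 1 2)` in `A₅`, `S = ⟨A, B⟩ = {1, A, B, AB}` (a Klein
four-group), `H = N_{A₅}(S)` (so `C ∈ H`, `3 ∣ |H|`, hence `3 ∤ [A₅ : H]` as `9 ∤ 60`; and `3 ∤ |S|`
since `S` has exponent `2`).
1. *Linear algebra* (`fixed_eq_zero`): with `a = ρ(A)`, `b = ρ(B)`, `c = ρ(C)` (`a² = b² = 1`,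
   `ab = ba`, `ca = ab·c`, `cb = a·c`, `c³ = 1`) the four commuting "idempotents"
   `e_{εδ} = (1 + εa)(1 + δb)` sum to `4 = 1` (char `3`) and `c` permutes the three sign-eigenlines
   `(+,−) → (−,−) → (−,+)` cyclically.  DICHOTOMY: either the `(+,−)`-part `e₁ = (1+a)(1−b)`
   kills every vector — then so do its `c`-conjugates `e₂`, `e₃`, hence `e₀ = 1` and `a = 1`, i.e.
   `A ∈ ker ρ ⊴ A₅`, so (simplicity of `A₅`, Mathlib's `alternatingGroup.isSimpleGroup`) `ρ` is
   trivial, contradicting irreducibility in dimension `3` (a line is a proper subrepresentation) —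
   or some `x₁ = e₁v ≠ 0`, and then a nonzero `S`-fixed vector `x₀` together with
   `x₁, c x₁, c² x₁` are four simultaneous `(a, b)`-eigenvectors with the four distinct sign pairs,
   hence linearly independent in a `3`-dimensional space — absurd.  So `V^S = 0`.
2. *Cohomology* (`subsingleton_H1_H2_of_fixed_eq_zero`; the tree's Brown III library cited BY
   NAME, not re-proved): `|S| ∈ kˣ` gives `Hʲ(S, V) = 0` for `j ≥ 1`
   (`isZero_groupCohomology_succ_of_isUnit_card`); inflation–restriction in higher degrees
   (`InflationRestriction.isIso_inflation`, `q = 3`) then makes `Hⁱ(H/S, V^S) → Hⁱ(H, V)` an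
   isomorphism for `i = 1, 2`, whose source is `0` because `V^S = 0` (`Rep.isZero_iff`,
   `Functor.map_isZero`); finally `[A₅ : H] ∈ kˣ` makes `res : Hⁱ(A₅, V) → Hⁱ(H, V) = 0` injective
   (`res_injective_of_isUnit_index`), so `Hⁱ(A₅, V)` is a subsingleton.
The group theory is stated for any group from the relations alone; the one finite computation is
`exists_klein_data` (kernel `decide` on three explicit even permutations); `|A₅| = 60` is the
landed `Serre1972.natCard_alternatingGroup_fin_five`.  No definitions, no `native_decide`, no
Literature fact as hypothesis, no `sorry`; axioms `propext`, `Classical.choice`, `Quot.sound`. -/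

set_option linter.dupNamespace false

namespace Summit.Langlands.Langlands.Theorems.EvenIcosahedralCMCornerDefectZeroA5

open CategoryTheory CategoryTheory.Limits
open Summit.Langlands.Langlands.Theses.EvenIcosahedralCMCorner

/-! ### A. Two commuting involutions and a normalising element of order three (any group) -/

/-- In any group, the subgroup generated by two commuting involutions `A, B` is `{1, A, B, AB}`. -/
theorem mem_closure_pair_iff {G : Type*} [Group G] {A B : G} (hAA : A * A = 1) (hBB : B * B = 1)
    (hAB : A * B = B * A) {x : G} :
    x ∈ Subgroup.closure ({A, B} : Set G) ↔ x = 1 ∨ x = A ∨ x = B ∨ x = A * B := by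
  have hBA : B * A = A * B := hAB.symm
  have hAA' : ∀ X : G, A * (A * X) = X := fun X => by rw [← mul_assoc, hAA, one_mul]
  have hBA' : ∀ X : G, B * (A * X) = A * (B * X) := fun X => by rw [← mul_assoc, hBA, mul_assoc]
  have hAi : A⁻¹ = A := inv_eq_of_mul_eq_one_right hAA
  have hBi : B⁻¹ = B := inv_eq_of_mul_eq_one_right hBB
  constructor
  · intro hx
    induction hx using Subgroup.closure_induction with
    | mem x hx =>
      simp only [Set.mem_insert_iff, Set.mem_singleton_iff] at hx
      rcases hx with rfl | rfl
      · exact Or.inr (Or.inl rfl)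
      · exact Or.inr (Or.inr (Or.inl rfl))
    | one => exact Or.inl rfl
    | mul x y _ _ ihx ihy =>
      rcases ihx with rfl | rfl | rfl | rfl <;> rcases ihy with rfl | rfl | rfl | rfl <;>
        simp [mul_assoc, hAA, hBB, hAA', hBA', hBA]
    | inv x _ ih =>
      rcases ih with rfl | rfl | rfl | rfl <;> simp [hAi, hBi, hBA]
  · rintro (rfl | rfl | rfl | rfl)
    · exact one_mem _
    · exact Subgroup.subset_closure (by simp)
    · exact Subgroup.subset_closure (by simp)
    · exact mul_mem (Subgroup.subset_closure (by simp)) (Subgroup.subset_closure (by simp))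

/-- `⟨A, B⟩` has exponent `2`. -/
theorem mul_self_eq_one_of_mem_closure_pair {G : Type*} [Group G] {A B : G} (hAA : A * A = 1)
    (hBB : B * B = 1) (hAB : A * B = B * A) {x : G} (hx : x ∈ Subgroup.closure ({A, B} : Set G)) :
    x * x = 1 := by
  rw [mem_closure_pair_iff hAA hBB hAB] at hx
  rcases hx with rfl | rfl | rfl | rfl
  · exact one_mul 1
  · exact hAA
  · exact hBB
  · calc A * B * (A * B) = A * (B * A) * B := by group
      _ = A * (A * B) * B := by rw [← hAB]
      _ = 1 := by rw [← mul_assoc, hAA, one_mul, hBB]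

/-- `3 ∤ |⟨A, B⟩|`: by Cauchy an element of order `3` would square to `1`. -/
theorem not_three_dvd_card_closure_pair {G : Type*} [Group G] [Finite G] {A B : G}
    (hAA : A * A = 1) (hBB : B * B = 1) (hAB : A * B = B * A) :
    ¬ 3 ∣ Nat.card (Subgroup.closure ({A, B} : Set G)) := by
  intro h3
  obtain ⟨x, hx⟩ := exists_prime_orderOf_dvd_card' 3 h3
  have hsq : x ^ 2 = 1 := by
    apply Subtype.ext
    simp only [pow_two, Subgroup.coe_mul, Subgroup.coe_one]
    exact mul_self_eq_one_of_mem_closure_pair hAA hBB hAB x.2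
  have hdvd : orderOf x ∣ 2 := orderOf_dvd_of_pow_eq_one hsq
  rw [hx] at hdvd; omega

/-- An element `C` with `C A C⁻¹ = AB`, `C B C⁻¹ = A` normalises `⟨A, B⟩`. -/
theorem mem_normalizer_closure_pair {G : Type*} [Group G] {A B C : G} (hAA : A * A = 1)
    (hBB : B * B = 1) (hAB : A * B = B * A) (hCA : C * A * C⁻¹ = A * B) (hCB : C * B * C⁻¹ = A) :
    C ∈ Subgroup.normalizer (Subgroup.closure ({A, B} : Set G) : Set G) := by
  rw [Subgroup.mem_normalizer_iff]
  intro h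
  rw [mem_closure_pair_iff hAA hBB hAB, mem_closure_pair_iff hAA hBB hAB]
  have hCAB : C * (A * B) * C⁻¹ = B := by
    calc C * (A * B) * C⁻¹ = (C * A * C⁻¹) * (C * B * C⁻¹) := by group
      _ = A * B * A := by rw [hCA, hCB]
      _ = A * (A * B) := by rw [mul_assoc, ← hAB]
      _ = B := by rw [← mul_assoc, hAA, one_mul]
  constructor
  · rintro (rfl | rfl | rfl | rfl)
    · exact Or.inl (by group)
    · exact Or.inr (Or.inr (Or.inr hCA))
    · exact Or.inr (Or.inl hCB)
    · exact Or.inr (Or.inr (Or.inl hCAB))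
  · intro hh
    have key : h = C⁻¹ * (C * h * C⁻¹) * C := by group
    rcases hh with h1 | h1 | h1 | h1 <;> rw [h1] at key <;> subst key
    · exact Or.inl (by group)
    · refine Or.inr (Or.inr (Or.inl ?_))
      conv_lhs => rw [← hCB]
      group
    · refine Or.inr (Or.inr (Or.inr ?_))
      conv_lhs => rw [← hCAB]
      group
    · refine Or.inr (Or.inl ?_)
      conv_lhs => rw [← hCA]
      group

/-- If a subgroup `H` of a group of order `60` contains an element of order `3`, then
`3 ∤ [G : H]` (as `9 ∤ 60`). -/
theorem not_three_dvd_index {G : Type*} [Group G] (hG : Nat.card G = 60) (H : Subgroup G)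
    {C : G} (hC : C ∈ H) (hCCC : C * C * C = 1) (hC1 : C ≠ 1) : ¬ 3 ∣ H.index := by
  have h3 : orderOf C = 3 := orderOf_eq_prime (by rw [pow_succ, pow_two]; exact hCCC) hC1
  have hdvd : 3 ∣ Nat.card H := by
    have hx := orderOf_dvd_natCard (⟨C, hC⟩ : H)
    rwa [Subgroup.orderOf_mk, h3] at hx
  intro h3i
  have h9 : 3 * 3 ∣ Nat.card G := by
    rw [← H.card_mul_index]
    exact Nat.mul_dvd_mul hdvd h3i
  rw [hG] at h9; omega

/-- **The concrete input.**  `A = (0 1)(2 3)`, `B = (0 2)(1 3)`, `C = (0 1 2)` in `A₅` satisfy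
`A² = B² = 1`, `AB = BA`, `CA = AB·C`, `CB = A·C` (i.e. `CAC⁻¹ = AB`, `CBC⁻¹ = A`), `C³ = 1`,
`A ≠ 1`, `C ≠ 1` — a kernel decision on explicit even permutations of `Fin 5`. -/
theorem exists_klein_data : ∃ A B C : alternatingGroup (Fin 5),
    A * A = 1 ∧ B * B = 1 ∧ A * B = B * A ∧ C * A = A * B * C ∧ C * B = A * C ∧
    C * A * C⁻¹ = A * B ∧ C * B * C⁻¹ = A ∧ C * C * C = 1 ∧ A ≠ 1 ∧ C ≠ 1 := by
  refine ⟨⟨Equiv.swap 0 1 * Equiv.swap 2 3, Equiv.Perm.mem_alternatingGroup.2 (by decide)⟩,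
    ⟨Equiv.swap 0 2 * Equiv.swap 1 3, Equiv.Perm.mem_alternatingGroup.2 (by decide)⟩,
    ⟨Equiv.swap 0 2 * Equiv.swap 0 1, Equiv.Perm.mem_alternatingGroup.2 (by decide)⟩, ?_⟩
  decide

/-! ### B. Linear algebra: no nonzero common fixed vector of `a` and `b` -/

/-- Projection onto the four simultaneous `(a, b)`-sign-eigenlines: from a vanishing combination of
eigenvectors with the four distinct sign pairs, each summand vanishes (uses `4 = 1`). -/
theorem proj_smul_eq_zero {k V : Type*} [Field k] [AddCommGroup V] [Module k V]
    (h4 : (4 : k) = 1) (a b : V →ₗ[k] V) {x₀ x₁ x₂ x₃ : V} {c₀ c₁ c₂ c₃ : k}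
    (ha0 : a x₀ = x₀) (hb0 : b x₀ = x₀) (ha1 : a x₁ = x₁) (hb1 : b x₁ = -x₁)
    (ha2 : a x₂ = -x₂) (hb2 : b x₂ = -x₂) (ha3 : a x₃ = -x₃) (hb3 : b x₃ = x₃)
    (hsum : c₀ • x₀ + c₁ • x₁ + c₂ • x₂ + c₃ • x₃ = 0) :
    c₀ • x₀ = 0 ∧ c₁ • x₁ = 0 ∧ c₂ • x₂ = 0 ∧ c₃ • x₃ = 0 := by
  have hA : c₀ • x₀ + c₁ • x₁ - c₂ • x₂ - c₃ • x₃ = 0 := by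
    have h := congrArg a hsum
    simp only [map_add, map_smul, map_zero, ha0, ha1, ha2, ha3, smul_neg] at h
    linear_combination (norm := module) h
  have hB : c₀ • x₀ - c₁ • x₁ - c₂ • x₂ + c₃ • x₃ = 0 := by
    have h := congrArg b hsum
    simp only [map_add, map_smul, map_zero, hb0, hb1, hb2, hb3, smul_neg] at h
    linear_combination (norm := module) h
  have hAB : c₀ • x₀ - c₁ • x₁ + c₂ • x₂ - c₃ • x₃ = 0 := by
    have h := congrArg a hB
    simp only [map_add, map_sub, map_smul, map_zero, ha0, ha1, ha2, ha3, smul_neg] at h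
    linear_combination (norm := module) h
  refine ⟨?_, ?_, ?_, ?_⟩
  · have h : (4 : k) • (c₀ • x₀) = 0 := by
      linear_combination (norm := module) hsum + hA + hB + hAB
    rwa [h4, one_smul] at h
  · have h : (4 : k) • (c₁ • x₁) = 0 := by
      linear_combination (norm := module) hsum + hA - hB - hAB
    rwa [h4, one_smul] at h
  · have h : (4 : k) • (c₂ • x₂) = 0 := by
      linear_combination (norm := module) hsum - hA - hB + hAB
    rwa [h4, one_smul] at h
  · have h : (4 : k) • (c₃ • x₃) = 0 := by
      linear_combination (norm := module) hsum - hA + hB - hAB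
    rwa [h4, one_smul] at h

/-- **The Klein-four eigenline dichotomy.**  Over a field of characteristic `3`, let `a, b, c` be
endomorphisms of a `3`-dimensional space with `a² = b² = 1`, `ab = ba`, `ca = ab·c`, `cb = a·c`,
`c³ = 1` (the relations of `(0 1)(2 3)`, `(0 2)(1 3)`, `(0 1 2)` in `A₄ ≤ A₅`) and `a ≠ 1`.  Then
`a` and `b` have no common nonzero fixed vector. -/
theorem fixed_eq_zero {k V : Type*} [Field k] [CharP k 3] [AddCommGroup V] [Module k V]
    (hdim : Module.finrank k V = 3) (a b c : V →ₗ[k] V)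
    (haa : ∀ v, a (a v) = v) (hbb : ∀ v, b (b v) = v) (hab : ∀ v, a (b v) = b (a v))
    (hca : ∀ v, c (a v) = a (b (c v))) (hcb : ∀ v, c (b v) = a (c v))
    (hccc : ∀ v, c (c (c v)) = v) (hna : ∃ v, a v ≠ v) :
    ∀ w, a w = w → b w = w → w = 0 := by
  intro w haw hbw
  by_contra hw
  have h3 : (3 : k) = 0 := by simpa using CharP.cast_eq_zero k 3
  have h4 : (4 : k) = 1 := by linear_combination h3
  have hba : ∀ v, b (a v) = a (b v) := fun v => (hab v).symm
  have hbc : ∀ v, b (c v) = c (a (b v)) := fun v => by rw [hca, hcb, hba, haa]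
  have hcinj : ∀ v, c v = 0 → v = 0 := fun v hv => by
    rw [← hccc v, hv, map_zero, map_zero]
  haveI : Module.Finite k V := Module.finite_of_finrank_eq_succ hdim
  by_cases hV1 : ∃ v, v - b v + (a v - a (b v)) ≠ 0
  · -- generic branch: four eigenvectors with distinct sign pairs in a `3`-space
    obtain ⟨v, hv⟩ := hV1
    set x₁ := v - b v + (a v - a (b v)) with hx₁
    have ha1 : a x₁ = x₁ := by
      simp only [hx₁, map_add, map_sub, haa]; abel
    have hb1 : b x₁ = -x₁ := by
      simp only [hx₁, map_add, map_sub, hbb, hba]; abel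
    have ha2 : a (c x₁) = -c x₁ := by rw [← hcb, hb1, map_neg]
    have hb2 : b (c x₁) = -c x₁ := by rw [hbc, hb1, map_neg, ha1, map_neg]
    have ha3 : a (c (c x₁)) = -c (c x₁) := by rw [← hcb, hb2, map_neg]
    have hb3 : b (c (c x₁)) = c (c x₁) := by rw [hbc, hb2, map_neg, ha2, neg_neg]
    have hx2 : c x₁ ≠ 0 := fun h => hv (hcinj _ h)
    have hx3 : c (c x₁) ≠ 0 := fun h => hx2 (hcinj _ h)
    have hli : LinearIndependent k ![w, x₁, c x₁, c (c x₁)] := by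
      rw [Fintype.linearIndependent_iff]
      intro g hg i
      simp only [Fin.sum_univ_four, Matrix.cons_val_zero, Matrix.cons_val_one,
        Matrix.cons_val_two, Matrix.cons_val_three] at hg
      obtain ⟨h0, h1, h2, h3'⟩ :=
        proj_smul_eq_zero h4 a b haw hbw ha1 hb1 ha2 hb2 ha3 hb3 hg
      fin_cases i
      · exact (smul_eq_zero.1 h0).resolve_right hw
      · exact (smul_eq_zero.1 h1).resolve_right hv
      · exact (smul_eq_zero.1 h2).resolve_right hx2
      · exact (smul_eq_zero.1 h3').resolve_right hx3
    have hle := hli.fintype_card_le_finrank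
    rw [Fintype.card_fin, hdim] at hle
    omega
  · -- special branch: the `(+,−)` eigenline is zero, hence so are its `c`-translates, so `a = 1`
    push Not at hV1
    have h2 : ∀ u, u - b u - (a u - a (b u)) = 0 := by
      intro u
      have h := congrArg c (hV1 (c (c u)))
      simp only [map_add, map_sub, map_zero, hccc, hcb, hca, hba, haa] at h
      linear_combination (norm := module) h
    have h3' : ∀ u, u + b u - (a u + a (b u)) = 0 := by
      intro u
      have h := congrArg c (h2 (c (c u)))
      simp only [map_sub, map_zero, hccc, hcb, hca, hba, haa] at h
      linear_combination (norm := module) h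
    have he0 : ∀ u, u + b u + (a u + a (b u)) = u := by
      intro u
      linear_combination (norm := module) h4 • u - hV1 u - h2 u - h3' u
    obtain ⟨v, hv⟩ := hna
    apply hv
    have key : a (v + b v + (a v + a (b v))) = v + b v + (a v + a (b v)) := by
      simp only [map_add, haa]; abel
    rwa [he0 v] at key

/-- In an irreducible `3`-dimensional representation of `A₅` every `g ≠ 1` moves some vector (else
`g ∈ ker ρ ⊴ A₅`, so `ρ` is trivial by simplicity, and a line is a proper nonzero
subrepresentation). -/
theorem exists_not_fixed {k : Type} [Field k] (V : Rep k (alternatingGroup (Fin 5)))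
    (hdim : Module.finrank k V = 3) (hirr : V.ρ.IsIrreducible) {g : alternatingGroup (Fin 5)}
    (hg : g ≠ 1) : ∃ v : V, V.ρ g v ≠ v := by
  by_contra hall
  push Not at hall
  haveI : IsSimpleGroup (alternatingGroup (Fin 5)) := alternatingGroup.isSimpleGroup (by simp)
  have hker : V.ρ.ker = ⊤ := by
    refine ((MonoidHom.normal_ker V.ρ).eq_bot_or_eq_top).resolve_left ?_
    intro hbot
    have hmem : g ∈ V.ρ.ker := by
      rw [MonoidHom.mem_ker]
      exact LinearMap.ext hall
    rw [hbot, Subgroup.mem_bot] at hmem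
    exact hg hmem
  have htriv : ∀ g, V.ρ g = 1 := fun g => by
    rw [← MonoidHom.mem_ker, hker]; exact Subgroup.mem_top g
  obtain ⟨v, hv⟩ : ∃ v : V, v ≠ 0 := by
    by_contra h
    push Not at h
    haveI : Subsingleton V := ⟨fun x y => by rw [h x, h y]⟩
    rw [Module.finrank_zero_of_subsingleton] at hdim
    exact absurd hdim (by norm_num)
  let W : Subrepresentation V.ρ :=
    ⟨Submodule.span k {v}, fun g x hx => by rw [htriv g]; exact hx⟩
  haveI := hirr
  rcases eq_bot_or_eq_top W with hW | hW
  · have hvW : v ∈ W.toSubmodule := Submodule.mem_span_singleton_self v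
    rw [hW] at hvW
    change v ∈ (⊥ : Submodule k V) at hvW
    exact hv ((Submodule.mem_bot k).1 hvW)
  · have h1 : Module.finrank k (Submodule.span k {v}) = 1 := finrank_span_singleton hv
    have htop : Submodule.span k {v} = (⊤ : Submodule k V) :=
      congrArg Subrepresentation.toSubmodule hW
    rw [htop, finrank_top, hdim] at h1
    omega

/-! ### C. Cohomology: a `3'`-subgroup without fixed vectors, normal in a subgroup of `3'`-index -/

/-- **Cohomological core** (Brown III, cited from the tree BY NAME).  `k` a field of
characteristic `3`, `G` finite, `S ≤ H ≤ G` with `S ⊴ H`, `3 ∤ |S|`, `3 ∤ [G : H]`, and `V` a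
representation of `G` without nonzero `S`-fixed vectors.  Then `H¹(G, V)` and `H²(G, V)` are
subsingletons: `Hʲ(S, V) = 0` (`j ≥ 1`, `|S| ∈ kˣ`), so inflation `Hⁱ(H/S, V^S) ⥲ Hⁱ(H, V)` is an
isomorphism for `i = 1, 2` with zero source (`V^S = 0`), and `res : Hⁱ(G, V) ↪ Hⁱ(H, V)` is
injective (`[G : H] ∈ kˣ`). -/
theorem subsingleton_H1_H2_of_fixed_eq_zero {k G : Type} [Field k] [CharP k 3] [Group G]
    [Finite G] (S H : Subgroup G) (hSH : S ≤ H) [(S.subgroupOf H).Normal]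
    (hS : ¬ 3 ∣ Nat.card S) (hH : ¬ 3 ∣ H.index) (V : Rep k G)
    (hfix : ∀ v : V, (∀ s : G, s ∈ S → V.ρ s v = v) → v = 0) :
    Subsingleton (groupCohomology.H1 V) ∧ Subsingleton (groupCohomology.H2 V) := by
  have hunitH : IsUnit ((H.index : ℕ) : k) :=
    Ne.isUnit fun h => hH ((CharP.cast_eq_zero_iff k 3 _).1 h)
  have hcardN : Nat.card (S.subgroupOf H) = Nat.card S :=
    Nat.card_congr (Subgroup.subgroupOfEquivOfLe hSH).toEquiv
  have hunitN : IsUnit ((Nat.card (S.subgroupOf H) : ℕ) : k) :=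
    Ne.isUnit fun h => hS (by rw [← hcardN]; exact (CharP.cast_eq_zero_iff k 3 _).1 h)
  -- (1) `Hʲ(S, V) = 0` for `1 ≤ j ≤ 2` (indeed all `j ≥ 1`)
  have hres : ∀ j : ℕ, 1 ≤ j → j ≤ 3 - 1 →
      IsZero (groupCohomology (Rep.res (S.subgroupOf H).subtype (Rep.res H.subtype V)) j) := by
    intro j hj _
    obtain ⟨i, rfl⟩ : ∃ i, j = i + 1 := ⟨j - 1, by omega⟩
    exact Literature.Algebra.Homology.isZero_groupCohomology_succ_of_isUnit_card _ hunitN i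
  -- (2) `(Res_H V)^S = 0` as a representation of `H / S`
  have hQ : IsZero ((Rep.res H.subtype V).quotientToInvariants (S.subgroupOf H)) := by
    rw [Rep.isZero_iff]
    refine ⟨fun x y => ?_⟩
    have h0 : ∀ z : Representation.invariants
        ((Rep.res H.subtype V).ρ.comp (S.subgroupOf H).subtype), (z : V) = 0 := by
      intro z
      have hz := z.2
      rw [Representation.mem_invariants] at hz
      exact hfix _ fun s hs => hz ⟨⟨s, hSH hs⟩, Subgroup.mem_subgroupOf.2 hs⟩
    exact Subtype.ext ((h0 x).trans (h0 y).symm)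
  -- (3) inflation `Hⁱ(H/S, 0) ⥲ Hⁱ(H, Res V)` is an isomorphism for `i = 1, 2`: the target vanishes
  have hH12 : ∀ i, i = 1 ∨ i = 2 → IsZero (groupCohomology (Rep.res H.subtype V) i) := by
    intro i hi
    haveI := Literature.Algebra.Homology.InflationRestriction.isIso_inflation (S.subgroupOf H)
      (Rep.res H.subtype V) 3 hres i (by omega) (by omega)
    exact ((groupCohomology.functor k _ i).map_isZero hQ).of_iso
      (asIso (Literature.Algebra.Homology.InflationRestriction.inflation (S.subgroupOf H)
        (Rep.res H.subtype V) i)).symm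
  -- (4) restriction to `H` is injective (`[G : H] ∈ kˣ`)
  have hinj := fun n => Literature.Algebra.Homology.res_injective_of_isUnit_index H V hunitH n
  refine ⟨?_, ?_⟩
  · haveI := ModuleCat.subsingleton_of_isZero (hH12 1 (Or.inl rfl))
    exact (hinj 1).subsingleton
  · haveI := ModuleCat.subsingleton_of_isZero (hH12 2 (Or.inr rfl))
    exact (hinj 2).subsingleton

/-! ### D. The item -/

/-- **stmt-Langlands-14080** `EvenIcosahedralCMCorner.DefectZeroA5`: for `k` of characteristic `3`
and `V` an irreducible `3`-dimensional `k`-representation of `A₅`, `H¹(A₅, V)` and `H²(A₅, V)` are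
subsingletons. -/
theorem defectZeroA5 : DefectZeroA5 := by
  intro k _ _ V hdim hirr
  obtain ⟨A, B, C, hAA, hBB, hAB, hCA, hCB, hCAc, hCBc, hCCC, hA1, hC1⟩ := exists_klein_data
  -- (1) `V^⟨A,B⟩ = 0` by the eigenline dichotomy
  have hW : ∀ w : V, V.ρ A w = w → V.ρ B w = w → w = 0 :=
    fixed_eq_zero hdim (V.ρ A) (V.ρ B) (V.ρ C)
      (fun v => show (V.ρ A * V.ρ A) v = v by
        rw [← map_mul, hAA, map_one]; rfl)
      (fun v => show (V.ρ B * V.ρ B) v = v by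
        rw [← map_mul, hBB, map_one]; rfl)
      (fun v => show (V.ρ A * V.ρ B) v = (V.ρ B * V.ρ A) v by
        rw [← map_mul, ← map_mul, hAB])
      (fun v => show (V.ρ C * V.ρ A) v = (V.ρ A * V.ρ B * V.ρ C) v by
        rw [← map_mul, ← map_mul, ← map_mul, hCA])
      (fun v => show (V.ρ C * V.ρ B) v = (V.ρ A * V.ρ C) v by
        rw [← map_mul, ← map_mul, hCB])
      (fun v => show (V.ρ C * V.ρ C * V.ρ C) v = v by
        rw [← map_mul, ← map_mul, hCCC, map_one]; rfl)
      (exists_not_fixed V hdim hirr hA1)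
  -- (2) cohomological core, `S = ⟨A, B⟩`, `H = N(S)` (`S ⊴ H`: `Subgroup.normal_in_normalizer`)
  have hA : A ∈ Subgroup.closure ({A, B} : Set (alternatingGroup (Fin 5))) :=
    Subgroup.subset_closure (by simp)
  have hB : B ∈ Subgroup.closure ({A, B} : Set (alternatingGroup (Fin 5))) :=
    Subgroup.subset_closure (by simp)
  exact subsingleton_H1_H2_of_fixed_eq_zero (Subgroup.closure {A, B})
    (Subgroup.normalizer (Subgroup.closure ({A, B} : Set (alternatingGroup (Fin 5))) : Set _))
    Subgroup.le_normalizer (not_three_dvd_card_closure_pair hAA hBB hAB)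
    (not_three_dvd_index
      Literature.NumberTheory.GaloisRepresentations.Serre1972.natCard_alternatingGroup_fin_five _
      (mem_normalizer_closure_pair hAA hBB hAB hCAc hCBc) hCCC hC1)
    V (fun v hv => hW v (hv A hA) (hv B hB))

end Summit.Langlands.Langlands.Theorems.EvenIcosahedralCMCornerDefectZeroA5
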